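import Summits.BirchSwinnertonDyer.BirchSwinnertonDyer.Theorems.CyclotomicUntwistNineGoodModelTransportCalculus
import Summits.BirchSwinnertonDyer.BirchSwinnertonDyer.Theorems.CyclotomicUntwistNineDescendedFrobeniusOfOmegaColumn
import HarnessLib

/-!
# MODEL INDEPENDENCE of `ClassesIndependent` / `IsPowerMapMatrix` / the `ω`-column datum, and the ONE-MODEL
# CRITERION for `IsDescendedFrobeniusMatrix` (route `CyclotomicUntwist`; lane «MODEL TRANSPORT ALONG THE 𝓞-CHANGE», 3/3)

Cell `pub/bsd-wall` (D-0145 line `route-BirchSwinnertonDyer-CyclotomicUntwist`), width seat `bsd-line-cycu-p4` (gen 8).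
THEOREMS ONLY (no definition, no instance, no named fact, no `sorry`); helper `--supports` K1 = stmt-BirchSwinnertonDyer-21580
(serves K2 = 21581 and the print child C2 = 27549). BSD is not proved by this file and no crux / stub is.

## What and why

`WeierstrassCurve.IsDescendedFrobeniusMatrix W M` (Literature `DescendedFrobeniusMatrix`, p623342) reads
`det M = 3 ∧ Nonempty W.NineGoodModel ∧ ∀ 𝓜, 𝓜.ClassesIndependent ∧ 𝓜.IsPowerMapMatrix 9 (M²) ∧ 𝓜.IsPowerMapMatrix 27 (M³)`
— universal over good models, so the existence fact `isDescendedFrobeniusMatrix_exists` (the print input of C2, reduced by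
cycu-p1 g6 to the `ω`-COLUMN TRANSFER `isDescendedFrobeniusMatrix_exists_of_omegaColumnTransfer`, whose hypothesis again
quantifies over EVERY good model) must serve all models with ONE datum. Parts 1–2 showed that the Néron representatives of two
good models correspond under the formal-group isomorphism `θ` of their `𝓞`-integral change of variables
(`classOmega_subst`, `exists_classEta_subst`), that `∘θ` preserves bounded denominators and commutes with the power maps
modulo bounded denominators. Here:

* §1 the transport engine `hbd_rel_of_rel` / `indep_of_indep` (any congruence `F(z^{3ᵏ}) ≡ x[ω] + y[η]`, any independence
  statement, moves between two good models with the SAME coefficients);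
* §2 **`isPowerMapMatrix_iff`** (`𝓜₁.IsPowerMapMatrix 3ᵏ N ↔ 𝓜₂.IsPowerMapMatrix 3ᵏ N`, same `N`), **`classesIndependent_iff`**,
  **`hbd_omegaColumn_iff`** (the `ω`-column datum `φ[ω] ≡ c[ω] + d[η]` of cycu-p1's reduction) and
  **`omegaPlaneIndependent_iff`** (independence of `([ω], φ[ω])`) — all MODEL-INDEPENDENT;
* §3 **`isDescendedFrobeniusMatrix_iff_exists`**: `W.IsDescendedFrobeniusMatrix M ↔ det M = 3 ∧ ∃ 𝓜, (clauses at 𝓜)`;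
  `isDescendedFrobeniusMatrix_of_model`; and **`isDescendedFrobeniusMatrix_exists_of_omegaColumnTransfer_one`** — cycu-p1's
  reduction with its hypothesis required on ONE good model only (the given supersingular one).

What the named fact still costs after this file: for a `W` with a supersingular good model `𝓜` over `𝓞`, ON THAT MODEL,
`∃ c d ∈ ℚ₃, d ≠ 0` with `φ[ω] ≡ c[ω] + d[η]` and `([ω], φ[ω])` independent modulo bounded denominators (Katz 1981 Thm 5.7.2 /
5.3.3); the rationality `c, d ∈ ℚ₃` (rather than `∈ ℚ₃(ζ₉)`) is the Galois-descent step, addressed separately.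

References: N. M. Katz, LNM 868 (1981) §5.1, Thm 5.1.4, 5.3.3, 5.7.2 [Katz1981CrystallineDieudonne]; P. Berthelot, A. Ogus,
Invent. Math. 72 (1983) (2.4), (3.14) [BerthelotOgus1983]; Silverman *AEC* VII.1.3 [SilvermanAEC2009].
-/

set_option autoImplicit false
-- single-conjunct summit: `Summit.BirchSwinnertonDyer.BirchSwinnertonDyer.…` repeats the name by design
set_option linter.dupNamespace false

noncomputable section

open scoped Classical
open PowerSeries WeierstrassCurve Literature.NumberTheory.EllipticCurves.DescendedFrobenius
  Summit.BirchSwinnertonDyer.BirchSwinnertonDyer.Theorems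
  Summit.BirchSwinnertonDyer.BirchSwinnertonDyer.Theorems.DescendedFrobeniusTransfer
  Summit.BirchSwinnertonDyer.BirchSwinnertonDyer.Theorems.NineGoodModelTransport
  Summit.BirchSwinnertonDyer.BirchSwinnertonDyer.Theorems.NineGoodModelTransportCalculus
  Summit.BirchSwinnertonDyer.BirchSwinnertonDyer.Theorems.NineDescendedFrobeniusOfOmegaColumn

namespace Summit.BirchSwinnertonDyer.BirchSwinnertonDyer.Theorems.DescendedFrobeniusOneModel

variable {W : WeierstrassCurve ℚ}

/-! ### §1 The transport engine along `θ : Ê₁ ⥲ Ê₂` -/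

section Engine

variable (𝓜₁ 𝓜₂ : W.NineGoodModel)

/-- **Transport of a power-map congruence.** If `F₂ ∈ K⟦z⟧` is log-type and `F₂ ∘ θ ≡ F₁`, then a congruence
`F₂(z^{3ᵏ}) ≡ x·classOmega 𝓜₂ + y·classEta 𝓜₂` implies `F₁(z^{3ᵏ}) ≡ x·classOmega 𝓜₁ + y·classEta 𝓜₁` with the SAME
`x, y` (all `≡` modulo bounded denominators; `θ` the isomorphism of the `𝓞`-integral change between the two good models).
[cite: Katz1981CrystallineDieudonne, Thm. 5.1.4 and §5.1 (functoriality)] -/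
theorem hbd_rel_of_rel {D : VariableChange ONine} (hD : D • 𝓜₁.E = 𝓜₂.E) (hDK : D.baseChange KNine = 𝓜₂.C * 𝓜₁.C⁻¹)
    {F₁ F₂ : KNine⟦X⟧} {dF : ℕ} (hlog : ∀ n : ℕ, IsIntegral ℤ_[3] ((3 : KNine) ^ dF * ((n : KNine) * coeff n F₂)))
    (hF : HasBoundedDenominators (F₂.subst (𝓜₁.curve.formalVariableChange (D.baseChange KNine)) - F₁)) (k : ℕ)
    {x y : KNine} (h : HasBoundedDenominators (expand (3 ^ k) (pow_ne_zero k (by norm_num)) F₂ - x • 𝓜₂.classOmega -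
      y • 𝓜₂.classEta)) :
    HasBoundedDenominators (expand (3 ^ k) (pow_ne_zero k (by norm_num)) F₁ - x • 𝓜₁.classOmega - y • 𝓜₁.classEta) := by
  set ι := algebraMap ONine KNine with hι
  obtain ⟨θ₀, hθ₀, hθ₀0⟩ := exists_map_eq_formalVariableChange_baseChange 𝓜₁.E D
  set θ := 𝓜₁.curve.formalVariableChange (D.baseChange KNine) with hθdef
  have hθ : θ₀.map ι = θ := hθ₀
  have hθs : HasSubst θ := 𝓜₁.curve.hasSubst_formalVariableChange _
  have hΩ := classOmega_subst hD hDK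
  obtain ⟨g, hη⟩ := exists_classEta_subst hD hDK
  rw [← hθdef] at hΩ hη
  have hG : HasBoundedDenominators (PowerSeries.C (𝓜₂.C.u : KNine) * g.map ι) :=
    hbd_C_mul _ ⟨0, fun n => by rw [pow_zero, one_mul]; exact isIntegral_coeff_map g n⟩
  have hcomm := hbd_expand_subst_sub_expand_subst hlog hθ₀0 k
  have h' := hbd_subst h hθ₀0
  rw [hθ] at hcomm h'
  have e : expand (3 ^ k) (pow_ne_zero k (by norm_num)) F₁ - x • 𝓜₁.classOmega - y • 𝓜₁.classEta =
      (expand (3 ^ k) (pow_ne_zero k (by norm_num)) F₂ - x • 𝓜₂.classOmega - y • 𝓜₂.classEta).subst θ -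
        ((expand (3 ^ k) (pow_ne_zero k (by norm_num)) F₂).subst θ -
          expand (3 ^ k) (pow_ne_zero k (by norm_num)) (F₂.subst θ)) -
        expand (3 ^ k) (pow_ne_zero k (by norm_num)) (F₂.subst θ - F₁) +
        y • (PowerSeries.C (𝓜₂.C.u : KNine) * g.map ι) := by
    rw [subst_sub hθs, subst_sub hθs, subst_smul hθs, subst_smul hθs, hΩ, hη, smul_add, map_sub]
    ring
  rw [e]
  exact ((h'.sub hcomm).sub (hbd_expand _ _ hF)).add (hbd_smul _ hG)

/-- **Transport of an independence statement.** If `F₂ ∘ θ ≡ F₁`, and on `𝓜₁` no non-trivial combination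
`x·classOmega 𝓜₁ + y·F₁` has bounded denominators, then the same holds for `x·classOmega 𝓜₂ + y·F₂` on `𝓜₂`.
[cite: Katz1981CrystallineDieudonne, Thm. 5.3.3 and §5.1 (functoriality)] -/
theorem indep_of_indep {D : VariableChange ONine} (hD : D • 𝓜₁.E = 𝓜₂.E) (hDK : D.baseChange KNine = 𝓜₂.C * 𝓜₁.C⁻¹)
    {F₁ F₂ : KNine⟦X⟧}
    (hF : HasBoundedDenominators (F₂.subst (𝓜₁.curve.formalVariableChange (D.baseChange KNine)) - F₁))
    (h : ∀ x y : KNine, HasBoundedDenominators (x • 𝓜₁.classOmega + y • F₁) → x = 0 ∧ y = 0) (x y : KNine)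
    (hxy : HasBoundedDenominators (x • 𝓜₂.classOmega + y • F₂)) : x = 0 ∧ y = 0 := by
  set ι := algebraMap ONine KNine with hι
  obtain ⟨θ₀, hθ₀, hθ₀0⟩ := exists_map_eq_formalVariableChange_baseChange 𝓜₁.E D
  set θ := 𝓜₁.curve.formalVariableChange (D.baseChange KNine) with hθdef
  have hθ : θ₀.map ι = θ := hθ₀
  have hθs : HasSubst θ := 𝓜₁.curve.hasSubst_formalVariableChange _
  have hΩ := classOmega_subst hD hDK
  rw [← hθdef] at hΩ
  have h' := hbd_subst hxy hθ₀0
  rw [hθ, subst_add hθs, subst_smul hθs, subst_smul hθs, hΩ] at h'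
  refine h x y ?_
  have e : x • 𝓜₁.classOmega + y • F₁ = x • 𝓜₁.classOmega + y • F₂.subst θ - y • (F₂.subst θ - F₁) := by
    rw [smul_sub]; abel
  rw [e]
  exact h'.sub (hbd_smul _ hF)

end Engine

/-! ### §2 Model independence -/

section Independence

variable (𝓜₁ 𝓜₂ : W.NineGoodModel)

/-- `classEta 𝓜₂ ∘ θ ≡ classEta 𝓜₁` modulo bounded denominators (part 1 `exists_classEta_subst`: the defect is
`u₂·g`, `g ∈ 𝓞⟦z⟧`). [cite: Katz1981CrystallineDieudonne, §5.1] -/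
theorem hbd_classEta_subst_sub {D : VariableChange ONine} (hD : D • 𝓜₁.E = 𝓜₂.E)
    (hDK : D.baseChange KNine = 𝓜₂.C * 𝓜₁.C⁻¹) :
    HasBoundedDenominators (𝓜₂.classEta.subst (𝓜₁.curve.formalVariableChange (D.baseChange KNine)) -
      𝓜₁.classEta) := by
  obtain ⟨g, hg⟩ := exists_classEta_subst hD hDK
  rw [hg, add_sub_cancel_left]
  exact hbd_C_mul _ ⟨0, fun n => by rw [pow_zero, one_mul]; exact isIntegral_coeff_map g n⟩

/-- The `ω`-representative of `𝓜₂` pulls back EXACTLY: `classOmega 𝓜₂ ∘ θ − classOmega 𝓜₁ = 0` has bounded denominators.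
[cite: Katz1981CrystallineDieudonne, §5.1] -/
theorem hbd_classOmega_subst_sub {D : VariableChange ONine} (hD : D • 𝓜₁.E = 𝓜₂.E)
    (hDK : D.baseChange KNine = 𝓜₂.C * 𝓜₁.C⁻¹) :
    HasBoundedDenominators (𝓜₂.classOmega.subst (𝓜₁.curve.formalVariableChange (D.baseChange KNine)) -
      𝓜₁.classOmega) := by
  rw [classOmega_subst hD hDK, sub_self]; exact HasBoundedDenominators.zero

/-- **`IsPowerMapMatrix` is MODEL-INDEPENDENT (one direction).** [cite: Katz1981CrystallineDieudonne, Thm. 5.1.4] -/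
theorem isPowerMapMatrix_of_isPowerMapMatrix (k : ℕ) {N : Matrix (Fin 2) (Fin 2) KNine}
    (h : 𝓜₂.IsPowerMapMatrix (3 ^ k) (pow_ne_zero k (by norm_num)) N) :
    𝓜₁.IsPowerMapMatrix (3 ^ k) (pow_ne_zero k (by norm_num)) N := by
  haveI := isElliptic_of_nineGoodModel 𝓜₁
  obtain ⟨D, hD, hDK⟩ := NineIntegers.exists_variableChange_smul_eq 𝓜₁ 𝓜₂
  obtain ⟨dΩ, hdΩ⟩ := logType_classOmega 𝓜₂
  obtain ⟨dη, hdη⟩ := logType_classEta 𝓜₂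
  exact ⟨hbd_rel_of_rel 𝓜₁ 𝓜₂ hD hDK hdΩ (hbd_classOmega_subst_sub 𝓜₁ 𝓜₂ hD hDK) k h.1,
    hbd_rel_of_rel 𝓜₁ 𝓜₂ hD hDK hdη (hbd_classEta_subst_sub 𝓜₁ 𝓜₂ hD hDK) k h.2⟩

/-- **MODEL INDEPENDENCE of `IsPowerMapMatrix`: the matrix of `z ↦ z^{3ᵏ}` on the Néron classes is the same for all good
models.** [cite: Katz1981CrystallineDieudonne, Thm. 5.1.4] -/
theorem isPowerMapMatrix_iff (k : ℕ) (N : Matrix (Fin 2) (Fin 2) KNine) :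
    𝓜₁.IsPowerMapMatrix (3 ^ k) (pow_ne_zero k (by norm_num)) N ↔
      𝓜₂.IsPowerMapMatrix (3 ^ k) (pow_ne_zero k (by norm_num)) N :=
  ⟨isPowerMapMatrix_of_isPowerMapMatrix 𝓜₂ 𝓜₁ k, isPowerMapMatrix_of_isPowerMapMatrix 𝓜₁ 𝓜₂ k⟩

/-- The same for an exponent `q` GIVEN as a power of `3` (`q = 9`, `q = 27` of the Literature predicate).
[cite: Katz1981CrystallineDieudonne, Thm. 5.1.4] -/
theorem isPowerMapMatrix_iff_of_eq_pow {q k : ℕ} (hq : q = 3 ^ k) (hq0 : q ≠ 0) (N : Matrix (Fin 2) (Fin 2) KNine) :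
    𝓜₁.IsPowerMapMatrix q hq0 N ↔ 𝓜₂.IsPowerMapMatrix q hq0 N := by
  subst hq
  exact isPowerMapMatrix_iff 𝓜₁ 𝓜₂ k N

/-- **`ClassesIndependent` is MODEL-INDEPENDENT (one direction).** [cite: Katz1981CrystallineDieudonne, Thm. 5.3.3] -/
theorem classesIndependent_of_classesIndependent (h : 𝓜₁.ClassesIndependent) : 𝓜₂.ClassesIndependent := by
  haveI := isElliptic_of_nineGoodModel 𝓜₁
  obtain ⟨D, hD, hDK⟩ := NineIntegers.exists_variableChange_smul_eq 𝓜₁ 𝓜₂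
  exact indep_of_indep 𝓜₁ 𝓜₂ hD hDK (hbd_classEta_subst_sub 𝓜₁ 𝓜₂ hD hDK) h

/-- **MODEL INDEPENDENCE of `ClassesIndependent`.** [cite: Katz1981CrystallineDieudonne, Thm. 5.3.3] -/
theorem classesIndependent_iff : 𝓜₁.ClassesIndependent ↔ 𝓜₂.ClassesIndependent :=
  ⟨classesIndependent_of_classesIndependent 𝓜₁ 𝓜₂, classesIndependent_of_classesIndependent 𝓜₂ 𝓜₁⟩

/-- **The `ω`-COLUMN DATUM is MODEL-INDEPENDENT**: `φ[ω] ≡ c[ω] + d[η]` (`φ = (z ↦ z^{3ᵏ})^*`, here any `3`-power) holds on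
`𝓜₁` iff it holds on `𝓜₂`, with the same `c, d ∈ ℚ₃(ζ₉)` — the hypothesis `hω` of cycu-p1's
`isDescendedFrobeniusMatrix_exists_of_omegaColumnTransfer` is `W`-intrinsic. [cite: Katz1981CrystallineDieudonne, Thm. 5.1.4] -/
theorem hbd_omegaColumn_iff (k : ℕ) (c d : KNine) :
    HasBoundedDenominators (expand (3 ^ k) (pow_ne_zero k (by norm_num)) 𝓜₁.classOmega -
        PowerSeries.C c * 𝓜₁.classOmega - PowerSeries.C d * 𝓜₁.classEta) ↔
      HasBoundedDenominators (expand (3 ^ k) (pow_ne_zero k (by norm_num)) 𝓜₂.classOmega -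
        PowerSeries.C c * 𝓜₂.classOmega - PowerSeries.C d * 𝓜₂.classEta) := by
  haveI := isElliptic_of_nineGoodModel 𝓜₁
  simp only [← smul_eq_C_mul]
  constructor
  · intro h
    obtain ⟨D, hD, hDK⟩ := NineIntegers.exists_variableChange_smul_eq 𝓜₂ 𝓜₁
    obtain ⟨dΩ, hdΩ⟩ := logType_classOmega 𝓜₁
    exact hbd_rel_of_rel 𝓜₂ 𝓜₁ hD hDK hdΩ (hbd_classOmega_subst_sub 𝓜₂ 𝓜₁ hD hDK) k h
  · intro h
    obtain ⟨D, hD, hDK⟩ := NineIntegers.exists_variableChange_smul_eq 𝓜₁ 𝓜₂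
    obtain ⟨dΩ, hdΩ⟩ := logType_classOmega 𝓜₂
    exact hbd_rel_of_rel 𝓜₁ 𝓜₂ hD hDK hdΩ (hbd_classOmega_subst_sub 𝓜₁ 𝓜₂ hD hDK) k h

/-- `φ[ω]` pulls back to `φ[ω]` modulo bounded denominators: `(classOmega 𝓜₂)(z^{3ᵏ}) ∘ θ ≡ (classOmega 𝓜₁)(z^{3ᵏ})`.
[cite: Katz1981CrystallineDieudonne, Thm. 5.1.4] -/
theorem hbd_expand_classOmega_subst_sub {D : VariableChange ONine} (hD : D • 𝓜₁.E = 𝓜₂.E)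
    (hDK : D.baseChange KNine = 𝓜₂.C * 𝓜₁.C⁻¹) (k : ℕ) :
    HasBoundedDenominators ((expand (3 ^ k) (pow_ne_zero k (by norm_num)) 𝓜₂.classOmega).subst
        (𝓜₁.curve.formalVariableChange (D.baseChange KNine)) -
      expand (3 ^ k) (pow_ne_zero k (by norm_num)) 𝓜₁.classOmega) := by
  obtain ⟨θ₀, hθ₀, hθ₀0⟩ := exists_map_eq_formalVariableChange_baseChange 𝓜₁.E D
  obtain ⟨dΩ, hdΩ⟩ := logType_classOmega 𝓜₂
  have hcomm := hbd_expand_subst_sub_expand_subst hdΩ hθ₀0 k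
  rw [hθ₀] at hcomm
  have hc : 𝓜₁.curve = 𝓜₁.E.map (algebraMap ONine KNine) := rfl
  rw [hc, ← classOmega_subst hD hDK]
  exact hcomm

/-- **INDEPENDENCE OF `([ω], φ[ω])` is MODEL-INDEPENDENT** (`φ = (z ↦ z^{3ᵏ})^*`) — the hypothesis `hind` of cycu-p1's
`isDescendedFrobeniusMatrix_exists_of_omegaColumnTransfer` is `W`-intrinsic. [cite: Katz1981CrystallineDieudonne, Thm. 5.3.3] -/
theorem omegaPlaneIndependent_iff (k : ℕ) :
    (∀ x y : KNine, HasBoundedDenominators (PowerSeries.C x * 𝓜₁.classOmega +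
        PowerSeries.C y * expand (3 ^ k) (pow_ne_zero k (by norm_num)) 𝓜₁.classOmega) → x = 0 ∧ y = 0) ↔
      (∀ x y : KNine, HasBoundedDenominators (PowerSeries.C x * 𝓜₂.classOmega +
        PowerSeries.C y * expand (3 ^ k) (pow_ne_zero k (by norm_num)) 𝓜₂.classOmega) → x = 0 ∧ y = 0) := by
  haveI := isElliptic_of_nineGoodModel 𝓜₁
  simp only [← smul_eq_C_mul]
  constructor
  · intro h
    obtain ⟨D, hD, hDK⟩ := NineIntegers.exists_variableChange_smul_eq 𝓜₁ 𝓜₂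
    exact indep_of_indep 𝓜₁ 𝓜₂ hD hDK (hbd_expand_classOmega_subst_sub 𝓜₁ 𝓜₂ hD hDK k) h
  · intro h
    obtain ⟨D, hD, hDK⟩ := NineIntegers.exists_variableChange_smul_eq 𝓜₂ 𝓜₁
    exact indep_of_indep 𝓜₂ 𝓜₁ hD hDK (hbd_expand_classOmega_subst_sub 𝓜₂ 𝓜₁ hD hDK k) h

end Independence

/-! ### §3 THE ONE-MODEL CRITERION for the descended Frobenius matrix -/

/-- **ONE-MODEL CRITERION.** `M` is THE descended Frobenius matrix of `W` (Literature `IsDescendedFrobeniusMatrix`,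
quantifying over ALL good models) iff `det M = 3` and the three clauses hold for SOME good model — the `∀ 𝓜` of the
definition is discharged by model independence (§2). [cite: BerthelotOgus1983, Prop. (3.14)]
[cite: Katz1981CrystallineDieudonne, Thm. 5.1.4 and Thm. 5.3.3] -/
theorem isDescendedFrobeniusMatrix_iff_exists {M : Matrix (Fin 2) (Fin 2) ℚ_[3]} :
    W.IsDescendedFrobeniusMatrix M ↔ M.det = 3 ∧ ∃ 𝓜 : W.NineGoodModel, 𝓜.ClassesIndependent ∧
      𝓜.IsPowerMapMatrix 9 (by norm_num) ((M ^ 2).map (algebraMap ℚ_[3] KNine)) ∧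
      𝓜.IsPowerMapMatrix 27 (by norm_num) ((M ^ 3).map (algebraMap ℚ_[3] KNine)) := by
  constructor
  · rintro ⟨hdet, ⟨𝓜⟩, h⟩
    exact ⟨hdet, 𝓜, h 𝓜⟩
  · rintro ⟨hdet, 𝓜, hI, h9, h27⟩
    refine ⟨hdet, ⟨𝓜⟩, fun 𝓜' => ⟨classesIndependent_of_classesIndependent 𝓜 𝓜' hI, ?_, ?_⟩⟩
    · exact (isPowerMapMatrix_iff_of_eq_pow 𝓜 𝓜' (k := 2) (by norm_num) (by norm_num) _).mp h9
    · exact (isPowerMapMatrix_iff_of_eq_pow 𝓜 𝓜' (k := 3) (by norm_num) (by norm_num) _).mp h27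

/-- **Sufficient form**, for the lanes producing the clauses on ONE model: `det M = 3` + the three clauses at a single
good model give `IsDescendedFrobeniusMatrix W M`. [cite: BerthelotOgus1983, Prop. (3.14)]
[cite: Katz1981CrystallineDieudonne, Thm. 5.1.4 and Thm. 5.3.3] -/
theorem isDescendedFrobeniusMatrix_of_model {M : Matrix (Fin 2) (Fin 2) ℚ_[3]}
    (hdet : M.det = 3) (𝓜 : W.NineGoodModel) (hI : 𝓜.ClassesIndependent)
    (h9 : 𝓜.IsPowerMapMatrix 9 (by norm_num) ((M ^ 2).map (algebraMap ℚ_[3] KNine)))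
    (h27 : 𝓜.IsPowerMapMatrix 27 (by norm_num) ((M ^ 3).map (algebraMap ℚ_[3] KNine))) :
    W.IsDescendedFrobeniusMatrix M :=
  isDescendedFrobeniusMatrix_iff_exists.mpr ⟨hdet, 𝓜, hI, h9, h27⟩

/-- **THE NAMED FACT FROM THE `ω`-COLUMN TRANSFER ON ONE MODEL.** cycu-p1's
`isDescendedFrobeniusMatrix_exists_of_omegaColumnTransfer` with its hypothesis required only on THE GIVEN (supersingular) good
model: if for every `W`, every good model `𝓜` over `𝓞` and `ρ` with `3 ∣ a(𝓜, ρ)` there are `c, d ∈ ℚ₃`, `d ≠ 0`, with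
`φ[ω] ≡ c[ω] + d[η]` and `([ω], φ[ω])` independent modulo bounded denominators ON `𝓜`, then
`WeierstrassCurve.isDescendedFrobeniusMatrix_exists`. (The transfer to every other good model is §2.)
[cite: Katz1981CrystallineDieudonne, Thm. 5.3.3 and Thm. 5.7.2] [cite: BerthelotOgus1983, Thm. (2.4) and Prop. (3.14)] -/
theorem isDescendedFrobeniusMatrix_exists_of_omegaColumnTransfer_one
    (H : ∀ (W : WeierstrassCurve ℚ) (𝓜 : W.NineGoodModel) (ρ : ONine →+* ZMod 3),
      (3 : ℤ) ∣ 𝓜.specialFibreTrace ρ →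
        ∃ c d : ℚ_[3], d ≠ 0 ∧
          HasBoundedDenominators (expand 3 (by norm_num) 𝓜.classOmega -
            PowerSeries.C (algebraMap ℚ_[3] KNine c) * 𝓜.classOmega -
            PowerSeries.C (algebraMap ℚ_[3] KNine d) * 𝓜.classEta) ∧
          (∀ x y : KNine, HasBoundedDenominators (PowerSeries.C x * 𝓜.classOmega +
            PowerSeries.C y * expand 3 (by norm_num) 𝓜.classOmega) → x = 0 ∧ y = 0)) :
    WeierstrassCurve.isDescendedFrobeniusMatrix_exists := by
  refine isDescendedFrobeniusMatrix_exists_of_omegaColumnTransfer fun W 𝓜 ρ hss => ?_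
  obtain ⟨c, d, hd, hω, hind⟩ := H W 𝓜 ρ hss
  refine ⟨c, d, hd, fun 𝓜' => ?_, fun 𝓜' => ?_⟩
  · exact (hbd_omegaColumn_iff 𝓜 𝓜' (k := 1) _ _).mp (by simpa using hω)
  · exact (omegaPlaneIndependent_iff 𝓜 𝓜' 1).mp (by simpa using hind)

end Summit.BirchSwinnertonDyer.BirchSwinnertonDyer.Theorems.DescendedFrobeniusOneModel

end
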